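/-
Copyright (c) 2026 the pub-hodgecm-mathlib formalisation cell (harness21).  Prover seat hodgecm-mathlib-F0P3a-p02 (g18): road «S3-ram», (Cnt2′) ROUTE B (chair
F0P3a-p07 (g15) RULING (13)(5), (14)(1)(2)): the FINITE half of the type-(2) root collar census, II — the census at the root, both root planes; 2026-09-02.
-/
import Literature.NumberTheory.Rogawski1990.DepthZeroKappaTransferTypeTwoRamifiedBlockRootPlaneSums    -- p849328 (this seat): the five plane sums (I1)–(I5)
import Literature.NumberTheory.Rogawski1990.DepthZeroKappaTransferTypeOneRamifiedIsocelesRootCensus    -- ★ p847712 (lineage): frame∕params currency, `sum_ite_sq_eq_eq`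
import HarnessLib

/-!
# The type-(2) root census, II: NULL and CLASS root lines at the root of a type-(2) literal — the uniform law for BOTH root planes
# (Rogawski 1990 §4.9; Kottwitz 1986 §3; Lidl–Niederreiter Ch. 6 §2)

Topic `NumberTheory/Rogawski1990`; namespace `Literature.NumberTheory.Rogawski1990.TypeTwoBlockRoot`.  THEOREMS ONLY (no definition, no instance, no notation, no named
fact, no `sorry`); kernel lane `--supports stmt-HodgeConjecture-24833` (cell `pub/hodgecm-mathlib`, crux H413, road «S3-ram», count-neutral).  Statement-first
`F0/P3a/F0P3a-p02/g18/census/BlockRootCensus.statementfirst.v1.F0P3ap02g18.lean` (the four heads below, verbatim); blueprint CENSUS NOTE v2∕v3 (same directory);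
chair F0P3a-p07 (g15) RULING (14)(1): SHAPE (ii) — parametric atoms, the Jacobsthal atom `J(e) = Σ_x χ(x)χ(x² − e)` left symbolic (it is NOT polynomial in `q`).

THE MATHEMATICS (`k` finite, odd characteristic).  Frame data at the root of a type-(2) literal (★ p847712's currency): `Ā ∈ GL₃(k)` with `ᵗĀ·J̄₀·Ā = diag(δ)` and
`Ā⁻¹·Ȳ·Ā = B`, where now `B` is a scalar `B_{i₀i₀}` at the isolated index and a `{j,l}`-BLOCK (`B_{i₀j} = B_{i₀l} = B_{ji₀} = B_{li₀} = 0`) which is `diag(δ)`-SELF-ADJOINT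
(`δ_jB_{jl} = δ_lB_{lj}`), CENTRED (`B_{jj} + B_{ll} = 2B_{i₀i₀}`) and residually IRREDUCIBLE (`e := (B_{jj} − B_{i₀i₀})² + B_{jl}B_{lj}`, `χ(e) = −1`).  On the isotropic cone
the line value `ᵗw·diag(δ)B·w` equals the binary form `S(w_j,w_l) = δ_ja·w_j² + 2δ_jb·w_jw_l − δ_la·w_l²` (`a = B_{jj} − B_{i₀i₀}`, `b = B_{jl}`), and the cone fibre over a
plane vector `w ≠ 0` has `1 + χ(−δ_{i₀}⁻¹n(w))` points (§1).  Feeding the plane sums (I1)–(I5) of file I: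
* §2 (k × k × k) **NULL: `#{v ≠ 0 : cone, S = 0} = (q − 1)·(1 − χ(δ_jδ_l))`; CLASS: `2·#{v ≠ 0 : cone, χ(c₀S) = ε} = (q − 1)·(q + χ(δ_jδ_l) + ε·χ(c₀δ_{i₀}δ_jδ_l)·J(e))`**;
* §3 the same in the `Fin 3 → k` matrix currency and, by the frame change ★ `ncard_setOf_ne_zero_congr_frame_eq`, in the `J̄₀`-currency;
* §4 **THE ROOT LINE CENSUS** in the normalised-parameter currency of ★ `card_sub_one_mul_natCard_params_eq_ncard`: `#null = 1 − χ(δ_jδ_l)` (`= 1 − s·χ(−1)`,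
  `s = χ(−δ_jδ_l)` the root-plane type: hyperbolic `+1` ∕ anisotropic `−1`) and `2·#{χ(c₀Q) = ε} = q + χ(δ_jδ_l) + ε·κ·J(e)`, `κ = χ(c₀δ_{i₀}δ_jδ_l)` —
  numerically: 5424 + 298 exhaustive cases, `q ≤ 17`, 0 mismatch (CENSUS NOTE v2).  The scalar-block case (`B` diagonal, `y_j = y_l`) is ★ p847712 by name.
HONEST LABEL: HC_CM is proved only modulo the 2 remaining named inputs (hLiu418 24832, h413 24833) until rung 0 closes; finite-field algebra only, nothing printed is asserted.

## References
* [Rogawski1990] J. D. Rogawski, *Automorphic Representations of Unitary Groups in Three Variables*, Ann. of Math. Stud. 123 (1990), §4.9 Prop. 4.9.1 p. 55.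
* [Kottwitz1986] R. E. Kottwitz, *Base change for unit elements of Hecke algebras*, Compositio Math. 60 (1986), §3 (counting fixed lattices by residual data).
* [LidlNiederreiter1996] R. Lidl, H. Niederreiter, *Finite Fields*, 2nd ed. (1996), Def. 5.49, Thm. 6.26–6.27.
* [IrelandRosen1990] K. Ireland, M. Rosen, *A Classical Introduction to Modern Number Theory*, GTM 84, Ch. 8 §1–§3.
-/

set_option autoImplicit false

namespace Literature.NumberTheory.Rogawski1990.TypeTwoBlockRoot

open Finset Matrix
open Literature.NumberTheory.Automorphic Literature.NumberTheory.Automorphic.HermitianLattice Literature.NumberTheory.Automorphic.UnitaryGroup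
open Literature.LinearAlgebra.QuadraticFormCountCongruence Literature.GroupTheory.SpecificGroups
open Literature.NumberTheory.Rogawski1990

variable {k : Type*} [Field k] [Fintype k] [DecidableEq k]

/-! ## §1 The cone fibre over the root plane -/

/-- **THE CONE FIBRE.**  For `δ₀ ≠ 0` and any predicate `R` on the plane:
`#{v ≠ 0 : δ₀v.1² + δ₁v.2.1² + δ₂v.2.2² = 0 ∧ R(v.2)} = Σ_{w ≠ 0} [R w]·(1 + χ(−δ₀⁻¹·(δ₁w.1² + δ₂w.2²)))` — over `w = 0` there is no non-zero cone point, over `w ≠ 0`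
there are `#{v₀ : v₀² = −δ₀⁻¹n(w)} = 1 + χ(−δ₀⁻¹n(w))`. [cite: LidlNiederreiter1996, Thm. 6.26–6.27] [cite: Kottwitz1986, §3] -/
theorem card_cone_filter_eq_sum (hk : ringChar k ≠ 2) {δ₀ : k} (hδ₀ : δ₀ ≠ 0) (δ₁ δ₂ : k) (R : k × k → Prop) [DecidablePred R] :
    ((univ.filter fun v : k × k × k => v ≠ 0 ∧ δ₀ * v.1 ^ 2 + δ₁ * v.2.1 ^ 2 + δ₂ * v.2.2 ^ 2 = 0 ∧ R v.2).card : ℤ) =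
      ∑ w ∈ univ.filter (fun w : k × k => w ≠ 0), if R w then 1 + quadraticChar k (-δ₀⁻¹ * (δ₁ * w.1 ^ 2 + δ₂ * w.2 ^ 2)) else 0 := by
  rw [Finset.card_filter]
  push_cast
  rw [Fintype.sum_prod_type, Finset.sum_comm, Finset.sum_filter]
  refine Finset.sum_congr rfl fun w _ => ?_
  by_cases hw : w = 0
  · rw [if_neg (not_not.2 hw)]
    refine Finset.sum_eq_zero fun v₀ _ => if_neg ?_
    rintro ⟨h0, hc, -⟩
    rw [hw] at hc h0
    simp only [Prod.fst_zero, Prod.snd_zero, zero_pow two_ne_zero, mul_zero, add_zero] at hc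
    have hv : v₀ = 0 := by
      rcases mul_eq_zero.1 hc with h | h
      · exact absurd h hδ₀
      · exact (pow_eq_zero_iff two_ne_zero).1 h
    exact h0 (Prod.ext hv rfl)
  rw [if_pos hw]
  by_cases hR : R w
  · rw [if_pos hR]
    have hiff : ∀ v₀ : k, ((v₀, w) ≠ (0 : k × k × k) ∧ δ₀ * v₀ ^ 2 + δ₁ * w.1 ^ 2 + δ₂ * w.2 ^ 2 = 0 ∧ R w) ↔
        v₀ ^ 2 = -δ₀⁻¹ * (δ₁ * w.1 ^ 2 + δ₂ * w.2 ^ 2) := fun v₀ => by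
      constructor
      · rintro ⟨-, hc, -⟩
        field_simp
        linear_combination hc
      · intro h
        refine ⟨fun h0 => hw (Prod.ext_iff.1 h0).2, ?_, hR⟩
        have h' : δ₀ * v₀ ^ 2 = -(δ₁ * w.1 ^ 2 + δ₂ * w.2 ^ 2) := by
          rw [h, neg_mul, mul_neg, ← mul_assoc, mul_inv_cancel₀ hδ₀, one_mul]
        linear_combination h'
    simp_rw [hiff]
    rw [sum_ite_sq_eq_eq hk, add_comm]
  · rw [if_neg hR]
    refine Finset.sum_eq_zero fun v₀ _ => if_neg ?_
    rintro ⟨-, -, h⟩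
    exact hR h

/-! ## §2 The census in `k × k × k` (isolated coordinate `v.1`, root plane `(v.2.1, v.2.2)`) -/

/-- `χ(c₀v)² = 1 − [v = 0]` for `c₀ ≠ 0`. [cite: IrelandRosen1990, Ch. 8 §1] -/
theorem quadraticChar_mul_sq_eq {c₀ : k} (hc₀ : c₀ ≠ 0) (v : k) : quadraticChar k (c₀ * v) ^ 2 = 1 - if v = 0 then 1 else 0 := by
  by_cases hv : v = 0
  · rw [if_pos hv, hv, mul_zero, MulChar.map_zero]; norm_num
  · rw [if_neg hv, quadraticChar_sq_one (mul_ne_zero hc₀ hv)]; norm_num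

/-- `#{w ∈ k × k : w ≠ 0} = q² − 1` (as an integer). [cite: IrelandRosen1990, Ch. 8 §1] -/
theorem card_filter_ne_zero_prod_eq : ((univ.filter fun w : k × k => w ≠ 0).card : ℤ) = (Fintype.card k : ℤ) ^ 2 - 1 := by
  rw [Finset.filter_ne' univ (0 : k × k), Finset.card_erase_of_mem (Finset.mem_univ _), Finset.card_univ, Nat.cast_sub Fintype.card_pos,
    Fintype.card_prod, Nat.cast_mul, Nat.cast_one, sq]

/-- **NULL LINES, `k × k × k` currency: `#{v ≠ 0 : δ₀v.1² + δ₁v.2.1² + δ₂v.2.2² = 0 ∧ S(v.2) = 0} = (q − 1)·(1 − χ(δ₁δ₂))`** (`δ`'s non-zero, `δ₁b = δ₂b'`,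
`χ(a² + bb') = −1`): the cone fibre turns the count into (I1) + (I2). [cite: Rogawski1990, §4.9 Prop. 4.9.1 p. 55] [cite: Kottwitz1986, §3] -/
theorem card_iso_blockFrame_prod_null_eq (hk : ringChar k ≠ 2) {δ₀ δ₁ δ₂ : k} (hδ₀ : δ₀ ≠ 0) (hδ₁ : δ₁ ≠ 0) (hδ₂ : δ₂ ≠ 0)
    {a b b' : k} (hbb : δ₁ * b = δ₂ * b') (hirr : quadraticChar k (a ^ 2 + b * b') = -1) :
    ((univ.filter fun v : k × k × k => v ≠ 0 ∧ δ₀ * v.1 ^ 2 + δ₁ * v.2.1 ^ 2 + δ₂ * v.2.2 ^ 2 = 0 ∧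
        δ₁ * a * v.2.1 ^ 2 + 2 * δ₁ * b * v.2.1 * v.2.2 - δ₂ * a * v.2.2 ^ 2 = 0).card : ℤ) =
      (Fintype.card k - 1) * (1 - quadraticChar k (δ₁ * δ₂)) := by
  have hm : -δ₀⁻¹ ≠ 0 := neg_ne_zero.2 (inv_ne_zero hδ₀)
  rw [card_cone_filter_eq_sum hk hδ₀ δ₁ δ₂ (fun w : k × k => δ₁ * a * w.1 ^ 2 + 2 * δ₁ * b * w.1 * w.2 - δ₂ * a * w.2 ^ 2 = 0)]
  have hsplit : ∀ w : k × k, (if δ₁ * a * w.1 ^ 2 + 2 * δ₁ * b * w.1 * w.2 - δ₂ * a * w.2 ^ 2 = 0 then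
      (1 : ℤ) + quadraticChar k (-δ₀⁻¹ * (δ₁ * w.1 ^ 2 + δ₂ * w.2 ^ 2)) else 0) =
      (if δ₁ * a * w.1 ^ 2 + 2 * δ₁ * b * w.1 * w.2 - δ₂ * a * w.2 ^ 2 = 0 then (1 : ℤ) else 0) +
        (if δ₁ * a * w.1 ^ 2 + 2 * δ₁ * b * w.1 * w.2 - δ₂ * a * w.2 ^ 2 = 0 then quadraticChar k (-δ₀⁻¹ * (δ₁ * w.1 ^ 2 + δ₂ * w.2 ^ 2)) else 0) := fun w => by
    split_ifs <;> simp
  simp_rw [hsplit]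
  rw [Finset.sum_add_distrib, sum_ite_value_eq_zero_one hk hδ₁ hδ₂ hbb hirr, sum_ite_value_eq_zero_quadraticChar_norm hk hδ₁ hδ₂ hbb hirr hm, add_zero]

/-- **CLASS LINES, `k × k × k` currency (doubled): `2·#{v ≠ 0 : cone ∧ χ(c₀·S(v.2)) = ε} = (q − 1)·(q + χ(δ₁δ₂) + ε·χ(c₀δ₀δ₁δ₂)·J(e))`**, `J(e) = Σ_x χ(x)χ(x² − e)`,
`e = a² + bb'` (`c₀ ≠ 0`, `ε = ±1`): with `2·[χ = ε] = χ² + εχ` the doubled count is `(q² − 1) − (I1) + ((I3) − (I2)) + ε·((I4) + (I5))`.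
[cite: Rogawski1990, §4.9 Prop. 4.9.1 p. 55] [cite: Kottwitz1986, §3] [cite: LidlNiederreiter1996, Def. 5.49] -/
theorem two_mul_card_iso_blockFrame_prod_quadraticChar_eq (hk : ringChar k ≠ 2) {δ₀ δ₁ δ₂ : k} (hδ₀ : δ₀ ≠ 0) (hδ₁ : δ₁ ≠ 0) (hδ₂ : δ₂ ≠ 0)
    {a b b' : k} (hbb : δ₁ * b = δ₂ * b') (hirr : quadraticChar k (a ^ 2 + b * b') = -1) {c₀ : k} (hc₀ : c₀ ≠ 0) {ε : ℤ} (hε : ε = 1 ∨ ε = -1) :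
    2 * ((univ.filter fun v : k × k × k => v ≠ 0 ∧ δ₀ * v.1 ^ 2 + δ₁ * v.2.1 ^ 2 + δ₂ * v.2.2 ^ 2 = 0 ∧
        quadraticChar k (c₀ * (δ₁ * a * v.2.1 ^ 2 + 2 * δ₁ * b * v.2.1 * v.2.2 - δ₂ * a * v.2.2 ^ 2)) = ε).card : ℤ) =
      (Fintype.card k - 1) * (Fintype.card k + quadraticChar k (δ₁ * δ₂) +
        ε * quadraticChar k (c₀ * δ₀ * δ₁ * δ₂) * ∑ x : k, quadraticChar k x * quadraticChar k (x ^ 2 - (a ^ 2 + b * b'))) := by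
  have hm : -δ₀⁻¹ ≠ 0 := neg_ne_zero.2 (inv_ne_zero hδ₀)
  rw [card_cone_filter_eq_sum hk hδ₀ δ₁ δ₂ (fun w : k × k =>
    quadraticChar k (c₀ * (δ₁ * a * w.1 ^ 2 + 2 * δ₁ * b * w.1 * w.2 - δ₂ * a * w.2 ^ 2)) = ε), Finset.mul_sum]
  have hpt : ∀ w : k × k, 2 * (if quadraticChar k (c₀ * (δ₁ * a * w.1 ^ 2 + 2 * δ₁ * b * w.1 * w.2 - δ₂ * a * w.2 ^ 2)) = ε then
      (1 : ℤ) + quadraticChar k (-δ₀⁻¹ * (δ₁ * w.1 ^ 2 + δ₂ * w.2 ^ 2)) else 0) =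
      ((1 - (if δ₁ * a * w.1 ^ 2 + 2 * δ₁ * b * w.1 * w.2 - δ₂ * a * w.2 ^ 2 = 0 then (1 : ℤ) else 0)) +
        (quadraticChar k (-δ₀⁻¹ * (δ₁ * w.1 ^ 2 + δ₂ * w.2 ^ 2)) -
          (if δ₁ * a * w.1 ^ 2 + 2 * δ₁ * b * w.1 * w.2 - δ₂ * a * w.2 ^ 2 = 0 then quadraticChar k (-δ₀⁻¹ * (δ₁ * w.1 ^ 2 + δ₂ * w.2 ^ 2)) else 0))) +
        ε * (quadraticChar k (c₀ * (δ₁ * a * w.1 ^ 2 + 2 * δ₁ * b * w.1 * w.2 - δ₂ * a * w.2 ^ 2)) +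
          quadraticChar k (c₀ * (δ₁ * a * w.1 ^ 2 + 2 * δ₁ * b * w.1 * w.2 - δ₂ * a * w.2 ^ 2)) *
            quadraticChar k (-δ₀⁻¹ * (δ₁ * w.1 ^ 2 + δ₂ * w.2 ^ 2))) := fun w => by
    rw [two_mul_ite_quadraticChar_eq _ _ hε, quadraticChar_mul_sq_eq hc₀]
    split_ifs <;> ring
  simp_rw [hpt]
  rw [Finset.sum_add_distrib, Finset.sum_add_distrib, Finset.sum_sub_distrib, Finset.sum_sub_distrib, ← Finset.mul_sum, Finset.sum_add_distrib,
    Finset.sum_const, nsmul_eq_mul, mul_one, card_filter_ne_zero_prod_eq,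
    sum_ite_value_eq_zero_one hk hδ₁ hδ₂ hbb hirr, sum_quadraticChar_norm_eq_zero hk hδ₁ hδ₂ (-δ₀⁻¹),
    sum_ite_value_eq_zero_quadraticChar_norm hk hδ₁ hδ₂ hbb hirr hm, sum_quadraticChar_value_eq_zero hk hδ₁ hδ₂ hbb hirr c₀,
    sum_quadraticChar_value_mul_quadraticChar_norm hk hδ₀ hδ₁ hδ₂ hbb hirr c₀]
  ring

/-! ## §3 The census in the `Fin 3 → k` matrix currency (any isolated index) and in the `J̄₀`-frame -/

/-- Three pairwise distinct indices exhaust `Fin 3` (private index plumbing). [folklore] -/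
private theorem fin_three_eq_or_of_distinct' (i₀ j l m : Fin 3) (hij : i₀ ≠ j) (hil : i₀ ≠ l) (hjl : j ≠ l) : m = i₀ ∨ m = j ∨ m = l := by
  revert i₀ j l m hij hil hjl
  decide

/-- `Σ_m f m = f i₀ + f j + f l` for pairwise distinct `i₀, j, l : Fin 3` (private index plumbing). [folklore] -/
private theorem sum_univ_fin_three_of_distinct' {β : Type*} [AddCommMonoid β] (f : Fin 3 → β) {i₀ j l : Fin 3} (hij : i₀ ≠ j) (hil : i₀ ≠ l) (hjl : j ≠ l) :
    ∑ m, f m = f i₀ + f j + f l := by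
  have huniv : (univ : Finset (Fin 3)) = {i₀, j, l} := by
    ext m
    simp only [Finset.mem_univ, Finset.mem_insert, Finset.mem_singleton, true_iff]
    exact fin_three_eq_or_of_distinct' i₀ j l m hij hil hjl
  rw [huniv, Finset.sum_insert (by simp [hij, hil]), Finset.sum_insert (by simp [hjl]), Finset.sum_singleton, add_assoc]

omit [Fintype k] [DecidableEq k] in
/-- `ᵗw·(diag(δ)·B)·w = Σ_m Σ_n δ_m B_{mn} w_m w_n` — the value form of a general residual matrix in an orthogonal frame. [cite: LidlNiederreiter1996, Ch. 6 §2] -/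
theorem dotProduct_diagonal_mul_mulVec_self (δ : Fin 3 → k) (B : Matrix (Fin 3) (Fin 3) k) (w : Fin 3 → k) :
    w ⬝ᵥ ((diagonal δ * B) *ᵥ w) = ∑ m, ∑ n, δ m * B m n * w m * w n := by
  simp only [dotProduct, Matrix.mulVec, Matrix.diagonal_mul, Finset.mul_sum]
  exact Finset.sum_congr rfl fun m _ => Finset.sum_congr rfl fun n _ => by ring

/-- **MATRIX CURRENCY.**  For a centred self-adjoint block `B` (zeros against the isolated index `i₀`, `δ_jB_{jl} = δ_lB_{lj}`, `B_{jj} + B_{ll} = 2B_{i₀i₀}`) and ANY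
predicate `R`: `#{w ≠ 0 : ᵗw·diag(δ)·w = 0 ∧ R(ᵗw·diag(δ)B·w)} = #{v ≠ 0 : δ_{i₀}v.1² + δ_jv.2.1² + δ_lv.2.2² = 0 ∧ R(S(v.2))}` with
`S(X,Y) = δ_j(B_{jj} − B_{i₀i₀})X² + 2δ_jB_{jl}XY − δ_l(B_{jj} − B_{i₀i₀})Y²` — ON THE CONE the value is the block's binary form (the scalar part `B_{i₀i₀}·(cone) = 0` drops).
[cite: Rogawski1990, §4.9 Prop. 4.9.1 p. 55] [cite: Kottwitz1986, §3] -/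
theorem card_iso_blockFrame_pred_eq_card_prod {i₀ j l : Fin 3} (hij : i₀ ≠ j) (hil : i₀ ≠ l) (hjl : j ≠ l)
    (δ : Fin 3 → k) (B : Matrix (Fin 3) (Fin 3) k) (hB₁ : B i₀ j = 0) (hB₂ : B i₀ l = 0) (hB₃ : B j i₀ = 0) (hB₄ : B l i₀ = 0)
    (hadj : δ j * B j l = δ l * B l j) (htr : B j j + B l l = 2 * B i₀ i₀) (R : k → Prop) [DecidablePred R] :
    (univ.filter fun w : Fin 3 → k => w ≠ 0 ∧ w ⬝ᵥ (diagonal δ *ᵥ w) = 0 ∧ R (w ⬝ᵥ ((diagonal δ * B) *ᵥ w))).card =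
      (univ.filter fun v : k × k × k => v ≠ 0 ∧ δ i₀ * v.1 ^ 2 + δ j * v.2.1 ^ 2 + δ l * v.2.2 ^ 2 = 0 ∧
        R (δ j * (B j j - B i₀ i₀) * v.2.1 ^ 2 + 2 * δ j * B j l * v.2.1 * v.2.2 - δ l * (B j j - B i₀ i₀) * v.2.2 ^ 2)).card := by
  have hcongr : (univ.filter fun w : Fin 3 → k => w ≠ 0 ∧ w ⬝ᵥ (diagonal δ *ᵥ w) = 0 ∧ R (w ⬝ᵥ ((diagonal δ * B) *ᵥ w))) =
      univ.filter fun w : Fin 3 → k => ¬ (w i₀ = 0 ∧ w j = 0 ∧ w l = 0) ∧ δ i₀ * w i₀ ^ 2 + δ j * w j ^ 2 + δ l * w l ^ 2 = 0 ∧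
        R (δ j * (B j j - B i₀ i₀) * w j ^ 2 + 2 * δ j * B j l * w j * w l - δ l * (B j j - B i₀ i₀) * w l ^ 2) := by
    refine Finset.filter_congr fun w _ => ?_
    have h0 : w ≠ 0 ↔ ¬ (w i₀ = 0 ∧ w j = 0 ∧ w l = 0) := by
      refine not_congr ⟨fun h => by simp [h], fun h => funext fun m => ?_⟩
      rcases fin_three_eq_or_of_distinct' i₀ j l m hij hil hjl with rfl | rfl | rfl
      exacts [h.1, h.2.1, h.2.2]
    have hcone : w ⬝ᵥ (diagonal δ *ᵥ w) = δ i₀ * w i₀ ^ 2 + δ j * w j ^ 2 + δ l * w l ^ 2 := by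
      rw [dotProduct_diagonal_mulVec_self, sum_univ_fin_three_of_distinct' _ hij hil hjl]
    have hval : w ⬝ᵥ ((diagonal δ * B) *ᵥ w) = δ i₀ * B i₀ i₀ * w i₀ ^ 2 + δ j * B j j * w j ^ 2 + δ j * B j l * w j * w l +
        δ l * B l j * w l * w j + δ l * B l l * w l ^ 2 := by
      rw [dotProduct_diagonal_mul_mulVec_self, sum_univ_fin_three_of_distinct' _ hij hil hjl, sum_univ_fin_three_of_distinct' _ hij hil hjl,
        sum_univ_fin_three_of_distinct' _ hij hil hjl, sum_univ_fin_three_of_distinct' _ hij hil hjl, hB₁, hB₂, hB₃, hB₄]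
      ring
    rw [h0, hcone, hval]
    refine and_congr_right fun _ => and_congr_right fun hc => ?_
    rw [show δ i₀ * B i₀ i₀ * w i₀ ^ 2 + δ j * B j j * w j ^ 2 + δ j * B j l * w j * w l + δ l * B l j * w l * w j + δ l * B l l * w l ^ 2 =
      δ j * (B j j - B i₀ i₀) * w j ^ 2 + 2 * δ j * B j l * w j * w l - δ l * (B j j - B i₀ i₀) * w l ^ 2 by
        linear_combination (B i₀ i₀) * hc - (w j * w l) * hadj + (δ l * w l ^ 2) * htr]
  rw [hcongr, card_filter_fin_three_coords_eq hij hil hjl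
    (fun x y z => ¬ (x = 0 ∧ y = 0 ∧ z = 0) ∧ δ i₀ * x ^ 2 + δ j * y ^ 2 + δ l * z ^ 2 = 0 ∧
      R (δ j * (B j j - B i₀ i₀) * y ^ 2 + 2 * δ j * B j l * y * z - δ l * (B j j - B i₀ i₀) * z ^ 2))]
  exact congrArg Finset.card (Finset.filter_congr fun v _ =>
    and_congr_left fun _ => not_congr ⟨fun h => Prod.ext h.1 (Prod.ext h.2.1 h.2.2), fun h => by simp [h]⟩)

/-- **`J̄₀`-CURRENCY.**  If `Ā ∈ GL₃(k)` has `ᵗĀ·J̄₀·Ā = diag(δ)` and `Ā⁻¹·Ȳ·Ā = B` (centred self-adjoint block), then for ANY predicate `R`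
`#{x ≠ 0 : ᵗxJ̄₀x = 0 ∧ R(ᵗx(J̄₀Ȳ)x)} = #{v ≠ 0 : δ_{i₀}v.1² + δ_jv.2.1² + δ_lv.2.2² = 0 ∧ R(S(v.2))}` (★ frame change `x = Āw`).
[cite: Rogawski1990, §4.9 Prop. 4.9.1 p. 55] [cite: Kottwitz1986, §3] -/
theorem ncard_iso_antidiagonal_block_pred_eq_of_frame {i₀ j l : Fin 3} (hij : i₀ ≠ j) (hil : i₀ ≠ l) (hjl : j ≠ l)
    (δ : Fin 3 → k) (B : Matrix (Fin 3) (Fin 3) k) (hB₁ : B i₀ j = 0) (hB₂ : B i₀ l = 0) (hB₃ : B j i₀ = 0) (hB₄ : B l i₀ = 0)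
    (hadj : δ j * B j l = δ l * B l j) (htr : B j j + B l l = 2 * B i₀ i₀)
    (A : GL (Fin 3) k) (Y : Matrix (Fin 3) (Fin 3) k)
    (hG : ((A : Matrix (Fin 3) (Fin 3) k))ᵀ * ((StdForm.antidiagonal 3).over k) * (A : Matrix (Fin 3) (Fin 3) k) = diagonal δ)
    (hY : ((A⁻¹ : GL (Fin 3) k) : Matrix (Fin 3) (Fin 3) k) * Y * (A : Matrix (Fin 3) (Fin 3) k) = B)
    (R : k → Prop) [DecidablePred R] :
    {x : Fin 3 → k | x ≠ 0 ∧ x ⬝ᵥ (((StdForm.antidiagonal 3).over k) *ᵥ x) = 0 ∧ R (x ⬝ᵥ ((((StdForm.antidiagonal 3).over k) * Y) *ᵥ x))}.ncard =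
      (univ.filter fun v : k × k × k => v ≠ 0 ∧ δ i₀ * v.1 ^ 2 + δ j * v.2.1 ^ 2 + δ l * v.2.2 ^ 2 = 0 ∧
        R (δ j * (B j j - B i₀ i₀) * v.2.1 ^ 2 + 2 * δ j * B j l * v.2.1 * v.2.2 - δ l * (B j j - B i₀ i₀) * v.2.2 ^ 2)).card := by
  have h := ncard_setOf_ne_zero_congr_frame_eq A ((StdForm.antidiagonal 3).over k) Y (fun s t => s = 0 ∧ R t)
  simp only [hG, hY] at h
  rw [← h, ← Finset.coe_filter_univ, Set.ncard_coe_finset]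
  exact card_iso_blockFrame_pred_eq_card_prod hij hil hjl δ B hB₁ hB₂ hB₃ hB₄ hadj htr R

/-! ## §4 The ROOT LINE CENSUS of a type-(2) root (normalised-parameter currency) -/

/-- **PARAMETER CURRENCY** (★ `card_sub_one_mul_natCard_params_eq_ncard`): for a predicate `R` invariant under non-zero squares,
`(q − 1)·#{p : R(Q_Ȳ(x̄_p))} = #{v ≠ 0 : δ_{i₀}v.1² + δ_jv.2.1² + δ_lv.2.2² = 0 ∧ R(S(v.2))}`. [cite: Rogawski1990, §4.9 Prop. 4.9.1 p. 55] [cite: Kottwitz1986, §3] -/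
theorem card_sub_one_mul_natCard_params_blockFrame_pred_eq {i₀ j l : Fin 3} (hij : i₀ ≠ j) (hil : i₀ ≠ l) (hjl : j ≠ l)
    (δ : Fin 3 → k) (B : Matrix (Fin 3) (Fin 3) k) (hB₁ : B i₀ j = 0) (hB₂ : B i₀ l = 0) (hB₃ : B j i₀ = 0) (hB₄ : B l i₀ = 0)
    (hadj : δ j * B j l = δ l * B l j) (htr : B j j + B l l = 2 * B i₀ i₀)
    (A : GL (Fin 3) k) (Y : Matrix (Fin 3) (Fin 3) k)
    (hG : ((A : Matrix (Fin 3) (Fin 3) k))ᵀ * ((StdForm.antidiagonal 3).over k) * (A : Matrix (Fin 3) (Fin 3) k) = diagonal δ)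
    (hY : ((A⁻¹ : GL (Fin 3) k) : Matrix (Fin 3) (Fin 3) k) * Y * (A : Matrix (Fin 3) (Fin 3) k) = B)
    (R : k → Prop) [DecidablePred R] (hR : ∀ c t : k, c ≠ 0 → (R (c * c * t) ↔ R t)) :
    ((Fintype.card k : ℤ) - 1) * (Nat.card {p : Option {p : k × k // p.2 + (RingHom.id k) p.2 + p.1 * (RingHom.id k) p.1 = 0} //
        R ((p.elim (Pi.single 2 1) fun q => ![(1 : k), q.1.1, q.1.2]) ⬝ᵥ
          (((((StdForm.antidiagonal 3).over k) * Y) *ᵥ (p.elim (Pi.single 2 1) fun q => ![(1 : k), q.1.1, q.1.2]))))} : ℕ) =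
      ((univ.filter fun v : k × k × k => v ≠ 0 ∧ δ i₀ * v.1 ^ 2 + δ j * v.2.1 ^ 2 + δ l * v.2.2 ^ 2 = 0 ∧
        R (δ j * (B j j - B i₀ i₀) * v.2.1 ^ 2 + 2 * δ j * B j l * v.2.1 * v.2.2 - δ l * (B j j - B i₀ i₀) * v.2.2 ^ 2)).card : ℤ) := by
  have hmul := card_sub_one_mul_natCard_params_eq_ncard Y R hR
  rw [ncard_iso_antidiagonal_block_pred_eq_of_frame hij hil hjl δ B hB₁ hB₂ hB₃ hB₄ hadj htr A Y hG hY R] at hmul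
  have hq : (Nat.card k : ℤ) = Fintype.card k := by rw [Nat.card_eq_fintype_card]
  have h := congrArg (Nat.cast : ℕ → ℤ) hmul
  rw [Nat.cast_mul, Nat.cast_sub (Nat.one_le_iff_ne_zero.2 (Nat.card_pos (α := k)).ne'), hq, Nat.cast_one] at h
  exact h

/-- **ROOT LINE CENSUS OF A TYPE-(2) ROOT, NULL LINES: `#{p : Q_Ȳ(x̄_p) = 0} = 1 − χ(δ_jδ_l)`** — i.e. `1 − s·χ(−1)` with `s = χ(−δ_jδ_l)` the type of the root plane
(`+1` hyperbolic, `−1` anisotropic): `2` null root lines iff `χ(δ_jδ_l) = −1`, else `0`.  (Statement-first head, verbatim.)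
[cite: Rogawski1990, §4.9 Prop. 4.9.1 p. 55] [cite: Kottwitz1986, §3] -/
theorem natCard_params_blockFrame_null_eq (hk : ringChar k ≠ 2) {i₀ j l : Fin 3} (hij : i₀ ≠ j) (hil : i₀ ≠ l) (hjl : j ≠ l)
    (δ : Fin 3 → k) (hδ : ∀ m, δ m ≠ 0) (B : Matrix (Fin 3) (Fin 3) k)
    (hB₁ : B i₀ j = 0) (hB₂ : B i₀ l = 0) (hB₃ : B j i₀ = 0) (hB₄ : B l i₀ = 0)
    (hadj : δ j * B j l = δ l * B l j) (htr : B j j + B l l = 2 * B i₀ i₀)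
    (hirr : quadraticChar k ((B j j - B i₀ i₀) ^ 2 + B j l * B l j) = -1)
    (A : GL (Fin 3) k) (Y : Matrix (Fin 3) (Fin 3) k)
    (hG : ((A : Matrix (Fin 3) (Fin 3) k))ᵀ * ((StdForm.antidiagonal 3).over k) * (A : Matrix (Fin 3) (Fin 3) k) = diagonal δ)
    (hY : ((A⁻¹ : GL (Fin 3) k) : Matrix (Fin 3) (Fin 3) k) * Y * (A : Matrix (Fin 3) (Fin 3) k) = B) :
    ((Nat.card {p : Option {p : k × k // p.2 + (RingHom.id k) p.2 + p.1 * (RingHom.id k) p.1 = 0} //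
        (p.elim (Pi.single 2 1) fun q => ![(1 : k), q.1.1, q.1.2]) ⬝ᵥ
          (((((StdForm.antidiagonal 3).over k) * Y) *ᵥ (p.elim (Pi.single 2 1) fun q => ![(1 : k), q.1.1, q.1.2]))) = 0} : ℕ) : ℤ) =
      1 - quadraticChar k (δ j * δ l) := by
  have hq1 : (Fintype.card k : ℤ) - 1 ≠ 0 := by
    have : 1 < Fintype.card k := Fintype.one_lt_card
    omega
  have h := card_sub_one_mul_natCard_params_blockFrame_pred_eq hij hil hjl δ B hB₁ hB₂ hB₃ hB₄ hadj htr A Y hG hY (fun t => t = 0) (fun c t hc => by simp [hc])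
  rw [card_iso_blockFrame_prod_null_eq hk (hδ i₀) (hδ j) (hδ l) hadj hirr] at h
  exact mul_left_cancel₀ hq1 h

/-- **ROOT LINE CENSUS OF A TYPE-(2) ROOT, CLASS LINES (doubled): `2·#{p : χ(c₀·Q_Ȳ(x̄_p)) = ε} = q + χ(δ_jδ_l) + ε·χ(c₀δ_{i₀}δ_jδ_l)·J(e)`**,
`e = (B_{jj} − B_{i₀i₀})² + B_{jl}B_{lj}`, `J(e) = Σ_x χ(x)χ(x² − e)` the Jacobsthal atom (`= H₂(−e)` of ★ `JacobsthalSums`; `c₀ ≠ 0`, `ε = ±1`).  The same `J(e)` for both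
root planes — it is the block's invariant —, so cross-literal DIFFERENCES are `J`-free.  (Statement-first head, verbatim.)
[cite: Rogawski1990, §4.9 Prop. 4.9.1 p. 55] [cite: Kottwitz1986, §3] [cite: LidlNiederreiter1996, Def. 5.49] -/
theorem two_mul_natCard_params_blockFrame_quadraticChar_eq (hk : ringChar k ≠ 2) {i₀ j l : Fin 3} (hij : i₀ ≠ j) (hil : i₀ ≠ l) (hjl : j ≠ l)
    (δ : Fin 3 → k) (hδ : ∀ m, δ m ≠ 0) (B : Matrix (Fin 3) (Fin 3) k)
    (hB₁ : B i₀ j = 0) (hB₂ : B i₀ l = 0) (hB₃ : B j i₀ = 0) (hB₄ : B l i₀ = 0)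
    (hadj : δ j * B j l = δ l * B l j) (htr : B j j + B l l = 2 * B i₀ i₀)
    (hirr : quadraticChar k ((B j j - B i₀ i₀) ^ 2 + B j l * B l j) = -1)
    (A : GL (Fin 3) k) (Y : Matrix (Fin 3) (Fin 3) k)
    (hG : ((A : Matrix (Fin 3) (Fin 3) k))ᵀ * ((StdForm.antidiagonal 3).over k) * (A : Matrix (Fin 3) (Fin 3) k) = diagonal δ)
    (hY : ((A⁻¹ : GL (Fin 3) k) : Matrix (Fin 3) (Fin 3) k) * Y * (A : Matrix (Fin 3) (Fin 3) k) = B)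
    (c₀ : k) (hc₀ : c₀ ≠ 0) {ε : ℤ} (hε : ε = 1 ∨ ε = -1) :
    2 * ((Nat.card {p : Option {p : k × k // p.2 + (RingHom.id k) p.2 + p.1 * (RingHom.id k) p.1 = 0} //
        quadraticChar k (c₀ * ((p.elim (Pi.single 2 1) fun q => ![(1 : k), q.1.1, q.1.2]) ⬝ᵥ
          (((((StdForm.antidiagonal 3).over k) * Y) *ᵥ (p.elim (Pi.single 2 1) fun q => ![(1 : k), q.1.1, q.1.2]))))) = ε} : ℕ) : ℤ) =
      Fintype.card k + quadraticChar k (δ j * δ l) +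
        ε * quadraticChar k (c₀ * δ i₀ * δ j * δ l) * ∑ x : k, quadraticChar k x * quadraticChar k (x ^ 2 - ((B j j - B i₀ i₀) ^ 2 + B j l * B l j)) := by
  have hq1 : (Fintype.card k : ℤ) - 1 ≠ 0 := by
    have : 1 < Fintype.card k := Fintype.one_lt_card
    omega
  have hP : ∀ c t : k, c ≠ 0 → (quadraticChar k (c₀ * (c * c * t)) = ε ↔ quadraticChar k (c₀ * t) = ε) := fun c t hc => by
    rw [show c₀ * (c * c * t) = c₀ * t * c ^ 2 by ring, map_mul, map_pow, quadraticChar_sq_one hc, mul_one]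
  have h1 := card_sub_one_mul_natCard_params_blockFrame_pred_eq hij hil hjl δ B hB₁ hB₂ hB₃ hB₄ hadj htr A Y hG hY (fun t => quadraticChar k (c₀ * t) = ε) hP
  have h2 := two_mul_card_iso_blockFrame_prod_quadraticChar_eq hk (hδ i₀) (hδ j) (hδ l) hadj hirr hc₀ hε
  refine mul_left_cancel₀ hq1 ?_
  linear_combination 2 * h1 + h2

end Literature.NumberTheory.Rogawski1990.TypeTwoBlockRoot
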